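import Literature.MathematicalPhysics.QuantumFieldTheory.Balaban1983to89.B8LeafKnitZd3CubBdryBeta
import Literature.MathematicalPhysics.QuantumFieldTheory.Balaban1983to89.B8LeafKnitZd3CubOfThm33

/-!
# `Balaban1983to89.B8Prop6CubeMemberOfThm33Beta` — [Balaban1985RegularSpaces] PROPOSITION 6 (p. 99) ON THE CUBE FAMILY OF (1.131) FROM [4] THEOREM 3.3
# BY NAME — the N06 → N05 junction consumed in EDITION β (dag-n06-b's `SockB9P3D4β` ∕ `AvgAtβ`, with their A6 witness at truncation 0), and the N05 leaf face on it

statement-level skeleton of published theorems with citation tags; proofs where landed; nothing here is a claim about the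
Yang–Mills mass gap

PDF held: `paper:balaban1985-cmp99-regular-spaces-gauge-fixing` (journal page = PDF page + 74); pp. 77, 82, 86–88, 94, 98–101; [4]
`paper:balaban1985-cmp99-background-propagators` (3.16) p. 393, Thm 3.3 p. 399.

CITATION HEADER (lean-in-tree rule).  Cell `pub-ymgap` (HUMAN RULING D-0062, Track A), DAG node N05 = [B8], seat `pub-ymgap-dag-n05-e` g8 (R141 (C)
row s3b), 2026-08-27.  WHY: director-ym №189 (bus l.20645) booked this seat's four R-d junction knits (p530292 · p534210 · p536134 · p535431) «A6-VACUOUS —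
not of substance» (binder clash certified by dag-n06-b p537196; socket p539131); dag-lead RULING №189 (2) (l.20717) named dag-n06-b the one pen for the repair
(EDITION β = `SockB9P3D4β` ∕ `AvgAtβ` WITH an A6 witness in the same file — landed p541339) and this seat for the re-knit of ONE consumer on `SockB9P3D4β`.  The
consumer is NOT a one-token swap (ref-E g10 NIT-1, l.20905): the chain `B8Prop6CubeMemberBdryBeta` → `…GaugedBdryBeta`, `B8Thm4KLevelBdryBeta` →
`B8Thm4ConcreteBdryBeta` → `B8LeafKnitZd3CubBdryBeta` bounds the crossing terms of `|B₁|β` and discharges the boundary-layer law at the cubes.  THIS FILE is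
the junction knit on it: ★★★ `prop6Printed_zdCub_of_thm33β` (+ record form `prop6Printed_cubB8OfRecord_of_thm33β`), ★★ `b8LeafRS_zd3_map_of_sockD4βFamily`
(the N05 leaf face on any all-levels β family).  Kind «kernel-checked proof», theorems only, no `def`.

A6 LINE (director-ym №189 (3) STANDING RULE — knits with member-local ∕ socket hypotheses ship a satisfiability witness or cite one).  The member-local binder
set taken here (`hdict`, `hP6`, `hinv`, `hcurv`, `hlan`, `havg` = `DictAt`, `Prop6At`, `InvAt`, `CurvAt`, `LandauAt`, `AvgAtβ` at the cube sub-family) is,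
together with `Margin2` and Thm 3.3's (3.42)∕(3.46)∕(3.47) block for every unitary `U₀`, INHABITED at EVERY cube member of (1.131) at truncation `m = 0`:
dag-n06-b `B9SupplySockB9P3ZdBeta.Witness.binders_inhabited_cube_zero` (p541339 §4; trivial massive regime — `Δ′ := 0`, `DRD* := 0`, `Q*aQ := a·1`,
`G(U₀) := ext∘(D*_{U₀}D_{U₀} + a)⁻¹∘restr`; honest label theirs: NOT [4]'s operators), whence `Witness.sockB9P3D4β_at_nonvacuous_cube_zero`.  NOT WITNESSED:
the same binders at levels `m ≥ 1` (∀ M m is asked below — their inhabitation is [4] Sect. A + Thm 3.11, object-bound, dag-n06-b's label), `B9.Thm33Printed`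
(N06's node), Proposition 5's three sockets (N05's Prop.-5 lane; refuted∕unrefuted status per `B8LeafModelZdOfHFP` lineage).  So: the binder LEVEL that killed
the R-d knits is certified inhabited here at `m = 0`; joint satisfiability of the full ∀-m list is NOT claimed.

HONEST SCOPE.  By-name composition of landed theorems (dag-n06-b's β junction + this seat's β consumer); every socket∕binder a HYPOTHESIS; nothing of
[4]∕[Balaban1985RegularSpaces] proved or refuted; count-neutral; N05∕N06 NOT discharged; one finite `𝕋⁴` programme at fixed `ε`, Bałaban as printed; nothing
continuum ∕ ℝ⁴ ∕ OS ∕ mass-gap ∕ Clay.  No `sorry`, no `def`, no `instance`, no `notation`.  Unit `pub-ymgap-dag-n05-e` (g8), 2026-08-27.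
-/

noncomputable section

open NormedSpace

namespace Literature.MathematicalPhysics.QuantumFieldTheory.Balaban1983to89.B8Prop6CubeMemberOfThm33Beta

open B7Prop1Explicit B7Prop2Explicit B7Prop1Local B7Eq92Concrete
open B8Lemma1NonAbelian (mulCfg blockPairNA lemma1Printed_blockPairNA)
open B8LeafKnitRS (B8LeafRS)
open B8LeafModelZd (ZdIdx SockP5base SockP5 SockP5u)
open B8LeafModelZd3 (zdGF3)
open B8LeafModelZd3Map (thm2Printed_zd3_map_of_thm4)
open B8Eq131CubesAdmissible (cubeFam)
open B8CubeMemberZd (cubeLamS cubeLamB)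
open B8LeafKnitZd3CubOfPrinted (prop3Printed_of_C₂_le)
open B9SupplySockB9P3ZdLetters (OpsZd)
open B9SupplySockB9P3ZdLettersOmega (Margin2 margin2_cubeFam)
open B9SupplySockB9P3ZdAt (DictAt Prop6At InvAt CurvAt LandauAt)
open B9SupplySockB9P3ZdBeta (CrossB SockB9P3D4β AvgAtβ sockB9P3D4β_allLevels_of_thm33_on)
open B8LeafKnitZd3CubBdryBeta (prop6Printed_zdCub_of_sockD4βFamily)
open Node00 (CubeB8 zdCub)

-- `Site` alone could resolve to the torus sites of `Setup.lean`; re-export the `ℤ^d` sites of `B7Prop1Explicit`.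
export B7Prop1Explicit (Site)

variable {d : ℕ}

variable {𝔸 : Type} [CStarAlgebra 𝔸] [Nontrivial 𝔸]
variable {I₃ : Type} {lan : I₃ → B8.LandauData}

/-! ## §1 Proposition 6 on the cube members from Theorem 3.3 by name + the member-local binders in edition β + Proposition 5's sockets -/

/-- ★★★ **PROPOSITION 6 ON THE CUBE MEMBERS FROM [4] THEOREM 3.3 BY NAME, THE JUNCTION IN EDITION β — WINDOW-FREE.**  `B9.Thm33Printed` + dag-n06-b's six
member-local [4]-letter binders on the cube sub-family of (1.131) in edition β (`DictAt`, `Prop6At`, `InvAt`, `CurvAt`, `LandauAt`, ★ `AvgAtβ` — the (3.16)∕(1.56)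
averaging binder whose datum `|B₁|β` carries the level-0 crossing bonds) give, by dag-n06-b's `sockB9P3D4β_allLevels_of_thm33_on` (p541339), an all-levels
`SockB9P3D4β` family on the cube sub-family; this seat's `B8LeafKnitZd3CubBdryBeta.prop6Printed_zdCub_of_sockD4βFamily` turns it, with Proposition 5's three
sockets at an enlarged constant `B₀ˢ ≥ 1` (depending on Theorem 3.3's `B₀`, on `q`, `d`, `L`; packaged existentially), into `B8.Prop6Printed d L (5dL·B₀ˢ) c₁` on
`zdCub ∘ f` for every cube index `f`.  THE FIRST CONSUMED JUNCTION KNIT OF THE CUBE ROAD WHOSE JUNCTION HYPOTHESES ARE NOT CERTIFIED VACUOUS — A6 LINE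
(director-ym №189 (3)): the hypothesis set {`DictAt`, `Prop6At`, `InvAt`, `CurvAt`, `LandauAt`, `AvgAtβ`, `Margin2`, Thm 3.3's (3.42)∕(3.46)∕(3.47) block} of the
member supplier behind `hdict`…`havg` is INHABITED at every cube member of (1.131) at truncation `m = 0` by dag-n06-b's
`B9SupplySockB9P3ZdBeta.Witness.binders_inhabited_cube_zero` (trivial massive regime; honest label theirs), and the resulting socket holds there
(`Witness.sockB9P3D4β_at_nonvacuous_cube_zero`) — where the R-d socket is FALSE (p539131) and the R-d binders prove `False` (p537196, refuting p530292∕p534210∕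
p536134∕p535431).  NOT witnessed: the binders at levels `m ≥ 1` ([4] Sect. A + Thm 3.11, object-bound), `B9.Thm33Printed` itself (N06's node), Proposition
5's three sockets (N05's Prop.-5 lane).  No joint-satisfiability claim beyond that is made.
[cite: Balaban1985RegularSpaces, Prop. 6 p.99, Prop. 3 p.87, Thm 4 p.88, Prop. 5 p.94, (1.56)–(1.62) pp.86–87, (1.31) p.82, p.77; Balaban1985BackgroundPropagators, Thm 3.3 p.399, (3.16) p.393] -/
theorem prop6Printed_zdCub_of_thm33β (hd2 : 2 ≤ d) {L : ℕ} (hL : 2 ≤ L)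
    {I : Type} (geo : I → B9.Geometry) (bg : I → B9.Backgrounds) (GA : ∀ i, B9.KernelFamily (geo i) (bg i))
    (mem : ℝ → ZdIdx d L → ℕ → I)
    (ιCfg : ∀ (M : ℝ) (i : ZdIdx d L) (m : ℕ) (U₀ : Site d → Fin d → 𝔸ˣ), (∀ x κ, U₀ x κ ∈ unitaryUnits 𝔸) → (bg (mem M i m)).Cfg)
    (ιLoc : ∀ (M : ℝ) (i : ZdIdx d L) (m : ℕ), (Site d → Fin d → 𝔸) → (geo (mem M i m)).Loc)
    (ops : ℝ → ZdIdx d L → ℕ → OpsZd d 𝔸) {c35 c₆ K₆ M₃ a₃ c69 q : ℝ}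
    {Gp : ∀ i, B9.KernelFamily (geo i) (bg i)} (h33 : B9.Thm33Printed c35 geo bg Gp GA)
    -- dag-n06-b's member-local [4]-letter binders AT THE MEMBERS OF THE CUBE SUB-FAMILY, edition β for the averaging binder
    (hdict : ∀ (M : ℝ) (j : {i : ZdIdx d L // ∃ (a : Site d) (M ρ : ℕ), L ≤ ρ ∧ ρ ≤ M ∧ 11 * d < M ∧ L ≤ d * M ∧
          i.Ω = cubeFam false L a M ρ i.k ∧ i.Λs = cubeLamS L a M ρ i.k ∧ i.Λb = cubeLamB L a M ρ i.k}) (m : ℕ),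
      DictAt geo bg GA L mem ιCfg ιLoc ops M j.1 m)
    (hP6 : ∀ (M : ℝ) (j : {i : ZdIdx d L // ∃ (a : Site d) (M ρ : ℕ), L ≤ ρ ∧ ρ ≤ M ∧ 11 * d < M ∧ L ≤ d * M ∧
          i.Ω = cubeFam false L a M ρ i.k ∧ i.Λs = cubeLamS L a M ρ i.k ∧ i.Λb = cubeLamB L a M ρ i.k}) (m : ℕ),
      M₃ ≤ M → Prop6At bg L mem ιCfg c35 c₆ K₆ M j.1 m)
    (hinv : ∀ (M : ℝ) (j : {i : ZdIdx d L // ∃ (a : Site d) (M ρ : ℕ), L ≤ ρ ∧ ρ ≤ M ∧ 11 * d < M ∧ L ≤ d * M ∧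
          i.Ω = cubeFam false L a M ρ i.k ∧ i.Λs = cubeLamS L a M ρ i.k ∧ i.Λb = cubeLamB L a M ρ i.k}) (m : ℕ),
      M₃ ≤ M → InvAt bg L mem ιCfg ops c35 a₃ M j.1 m)
    (hcurv : ∀ (M : ℝ) (j : {i : ZdIdx d L // ∃ (a : Site d) (M ρ : ℕ), L ≤ ρ ∧ ρ ≤ M ∧ 11 * d < M ∧ L ≤ d * M ∧
          i.Ω = cubeFam false L a M ρ i.k ∧ i.Λs = cubeLamS L a M ρ i.k ∧ i.Λb = cubeLamB L a M ρ i.k}) (m : ℕ),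
      M₃ ≤ M → CurvAt bg L mem ιCfg ops c35 a₃ c69 M j.1 m)
    (hlan : ∀ (M : ℝ) (j : {i : ZdIdx d L // ∃ (a : Site d) (M ρ : ℕ), L ≤ ρ ∧ ρ ≤ M ∧ 11 * d < M ∧ L ≤ d * M ∧
          i.Ω = cubeFam false L a M ρ i.k ∧ i.Λs = cubeLamS L a M ρ i.k ∧ i.Λb = cubeLamB L a M ρ i.k}) (m : ℕ),
      M₃ ≤ M → LandauAt bg L mem ιCfg ops c35 a₃ M j.1 m)
    (havg : ∀ (M : ℝ) (j : {i : ZdIdx d L // ∃ (a : Site d) (M ρ : ℕ), L ≤ ρ ∧ ρ ≤ M ∧ 11 * d < M ∧ L ≤ d * M ∧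
          i.Ω = cubeFam false L a M ρ i.k ∧ i.Λs = cubeLamS L a M ρ i.k ∧ i.Λb = cubeLamB L a M ρ i.k}) (m : ℕ),
      AvgAtβ L ops q M j.1 m)
    (hc₆ : 0 < c₆) (hK₆ : 0 < K₆) (ha₃ : 0 < a₃) (hc69 : 0 ≤ c69) (hq : 0 ≤ q)
    {B₀' C₂ cu cP : ℝ} (hB₀' : 0 < B₀') (hC₂ : 2097152 * ((d : ℝ) + 1) ^ 2 ≤ C₂) (hcu : 0 < cu) (hcP : 0 < cP) :
    ∃ B₀S : ℝ, 1 ≤ B₀S ∧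
      ((∀ i : {i : ZdIdx d L // ∃ (a : Site d) (M ρ : ℕ), L ≤ ρ ∧ ρ ≤ M ∧ 11 * d < M ∧ L ≤ d * M ∧
          i.Ω = cubeFam false L a M ρ i.k ∧ i.Λs = cubeLamS L a M ρ i.k ∧ i.Λb = cubeLamB L a M ρ i.k},
          SockP5base (𝔸 := 𝔸) L B₀S B₀' cP i.1.η i.1.k i.1.Ω i.1.Λs) →
       (∀ i : {i : ZdIdx d L // ∃ (a : Site d) (M ρ : ℕ), L ≤ ρ ∧ ρ ≤ M ∧ 11 * d < M ∧ L ≤ d * M ∧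
          i.Ω = cubeFam false L a M ρ i.k ∧ i.Λs = cubeLamS L a M ρ i.k ∧ i.Λb = cubeLamB L a M ρ i.k},
          SockP5 (𝔸 := 𝔸) L B₀S B₀' cP i.1.η i.1.k i.1.Ω i.1.Λs) →
       (∀ i : {i : ZdIdx d L // ∃ (a : Site d) (M ρ : ℕ), L ≤ ρ ∧ ρ ≤ M ∧ 11 * d < M ∧ L ≤ d * M ∧
          i.Ω = cubeFam false L a M ρ i.k ∧ i.Λs = cubeLamS L a M ρ i.k ∧ i.Λb = cubeLamB L a M ρ i.k},
          SockP5u (𝔸 := 𝔸) L cP cu i.1.η i.1.k i.1.Ω i.1.Λs) →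
       ∃ c₁ : ℝ, 0 < c₁ ∧ ∀ {ι' : Type} (f : ι' → ZdIdx d L),
         B8.Prop6Printed d (L : ℝ) (5 * (d : ℝ) * L * B₀S) c₁ (fun j => zdCub 𝔸 L (f j))) := by
  have hL1 : 1 ≤ L := le_trans (by norm_num) hL
  -- the cube members have `Margin2` (ρ ≥ L ≥ 2)
  have hMJ : ∀ i : {i : ZdIdx d L // ∃ (a : Site d) (M ρ : ℕ), L ≤ ρ ∧ ρ ≤ M ∧ 11 * d < M ∧ L ≤ d * M ∧
      i.Ω = cubeFam false L a M ρ i.k ∧ i.Λs = cubeLamS L a M ρ i.k ∧ i.Λb = cubeLamB L a M ρ i.k}, Margin2 i.1.Ω := by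
    rintro ⟨i, a, M, ρ, hρ, -, -, -, hΩ, -, -⟩
    dsimp only
    rw [hΩ]
    exact margin2_cubeFam L a M (hL.trans hρ) i.k
  -- ONE call of dag-n06-b's β junction over the cube sub-family index
  obtain ⟨B₀, cP9, hB₀, hcP9, hall⟩ := sockB9P3D4β_allLevels_of_thm33_on geo bg GA L mem ιCfg ιLoc ops hd2 hL1 h33
    (Subtype.val : {i : ZdIdx d L // ∃ (a : Site d) (M ρ : ℕ), L ≤ ρ ∧ ρ ≤ M ∧ 11 * d < M ∧ L ≤ d * M ∧
      i.Ω = cubeFam false L a M ρ i.k ∧ i.Λs = cubeLamS L a M ρ i.k ∧ i.Λb = cubeLamB L a M ρ i.k} → ZdIdx d L) hMJ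
    hdict hP6 hinv hcurv hlan havg hc₆ hK₆ ha₃ hc69 hq
  have hBbd : 0 ≤ (20 * (d : ℝ) + 2) * max 1 (2 * B₀ * max 1 q) := by positivity
  refine ⟨max (max 1 (max 1 (2 * B₀ * max 1 q))) (4 * ((20 * (d : ℝ) + 2) * max 1 (2 * B₀ * max 1 q)) / ((d : ℝ) * L - 1)),
    (le_max_left _ _).trans (le_max_left _ _), fun SP5base SP5 SP5u => ?_⟩
  exact prop6Printed_zdCub_of_sockD4βFamily (𝔸 := 𝔸) hd2 hL hBbd hcP9 hB₀' hC₂ hcu hcP hall SP5base SP5 SP5u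

#print axioms prop6Printed_zdCub_of_thm33β

/-- ★ **THE RECORD FORM**: `prop6Printed_zdCub_of_thm33β` on NODE 00's member of record `Node00.cubB8OfRecord θ` (`f := Subtype.val` on `Node00.IdxB8 θ`):
the `p6` letter of the record knits from `B9.Thm33Printed` + the six member-local binders in edition β on the cube sub-family + Proposition 5's three sockets at
`(B₀ˢ, B₀′)` — window-free; constant `B₁ = 5dL·B₀ˢ`; A6 line as in `prop6Printed_zdCub_of_thm33β`.
[cite: Balaban1985RegularSpaces, Prop. 6 p.99, Thm 4 p.88, Prop. 3 p.87, Prop. 5 p.94, (1.59) p.86; Balaban1985BackgroundPropagators, Thm 3.3 p.399] -/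
theorem prop6Printed_cubB8OfRecord_of_thm33β (θ : Node00.Stage3Params) (hD : 2 ≤ θ.D)
    {I : Type} (geo : I → B9.Geometry) (bg : I → B9.Backgrounds) (GA : ∀ i, B9.KernelFamily (geo i) (bg i))
    (mem : ℝ → ZdIdx θ.D θ.L → ℕ → I)
    (ιCfg : ∀ (M : ℝ) (i : ZdIdx θ.D θ.L) (m : ℕ) (U₀ : Site θ.D → Fin θ.D → θ.𝔸ˣ), (∀ x κ, U₀ x κ ∈ unitaryUnits θ.𝔸) →
      (bg (mem M i m)).Cfg)
    (ιLoc : ∀ (M : ℝ) (i : ZdIdx θ.D θ.L) (m : ℕ), (Site θ.D → Fin θ.D → θ.𝔸) → (geo (mem M i m)).Loc)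
    (ops : ℝ → ZdIdx θ.D θ.L → ℕ → OpsZd θ.D θ.𝔸) {c35 c₆ K₆ M₃ a₃ c69 q : ℝ}
    {Gp : ∀ i, B9.KernelFamily (geo i) (bg i)} (h33 : B9.Thm33Printed c35 geo bg Gp GA)
    (hdict : ∀ (M : ℝ) (j : {i : ZdIdx θ.D θ.L // ∃ (a : Site θ.D) (M ρ : ℕ), θ.L ≤ ρ ∧ ρ ≤ M ∧ 11 * θ.D < M ∧ θ.L ≤ θ.D * M ∧
          i.Ω = cubeFam false θ.L a M ρ i.k ∧ i.Λs = cubeLamS θ.L a M ρ i.k ∧ i.Λb = cubeLamB θ.L a M ρ i.k}) (m : ℕ),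
      DictAt geo bg GA θ.L mem ιCfg ιLoc ops M j.1 m)
    (hP6 : ∀ (M : ℝ) (j : {i : ZdIdx θ.D θ.L // ∃ (a : Site θ.D) (M ρ : ℕ), θ.L ≤ ρ ∧ ρ ≤ M ∧ 11 * θ.D < M ∧ θ.L ≤ θ.D * M ∧
          i.Ω = cubeFam false θ.L a M ρ i.k ∧ i.Λs = cubeLamS θ.L a M ρ i.k ∧ i.Λb = cubeLamB θ.L a M ρ i.k}) (m : ℕ),
      M₃ ≤ M → Prop6At bg θ.L mem ιCfg c35 c₆ K₆ M j.1 m)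
    (hinv : ∀ (M : ℝ) (j : {i : ZdIdx θ.D θ.L // ∃ (a : Site θ.D) (M ρ : ℕ), θ.L ≤ ρ ∧ ρ ≤ M ∧ 11 * θ.D < M ∧ θ.L ≤ θ.D * M ∧
          i.Ω = cubeFam false θ.L a M ρ i.k ∧ i.Λs = cubeLamS θ.L a M ρ i.k ∧ i.Λb = cubeLamB θ.L a M ρ i.k}) (m : ℕ),
      M₃ ≤ M → InvAt bg θ.L mem ιCfg ops c35 a₃ M j.1 m)
    (hcurv : ∀ (M : ℝ) (j : {i : ZdIdx θ.D θ.L // ∃ (a : Site θ.D) (M ρ : ℕ), θ.L ≤ ρ ∧ ρ ≤ M ∧ 11 * θ.D < M ∧ θ.L ≤ θ.D * M ∧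
          i.Ω = cubeFam false θ.L a M ρ i.k ∧ i.Λs = cubeLamS θ.L a M ρ i.k ∧ i.Λb = cubeLamB θ.L a M ρ i.k}) (m : ℕ),
      M₃ ≤ M → CurvAt bg θ.L mem ιCfg ops c35 a₃ c69 M j.1 m)
    (hlan : ∀ (M : ℝ) (j : {i : ZdIdx θ.D θ.L // ∃ (a : Site θ.D) (M ρ : ℕ), θ.L ≤ ρ ∧ ρ ≤ M ∧ 11 * θ.D < M ∧ θ.L ≤ θ.D * M ∧
          i.Ω = cubeFam false θ.L a M ρ i.k ∧ i.Λs = cubeLamS θ.L a M ρ i.k ∧ i.Λb = cubeLamB θ.L a M ρ i.k}) (m : ℕ),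
      M₃ ≤ M → LandauAt bg θ.L mem ιCfg ops c35 a₃ M j.1 m)
    (havg : ∀ (M : ℝ) (j : {i : ZdIdx θ.D θ.L // ∃ (a : Site θ.D) (M ρ : ℕ), θ.L ≤ ρ ∧ ρ ≤ M ∧ 11 * θ.D < M ∧ θ.L ≤ θ.D * M ∧
          i.Ω = cubeFam false θ.L a M ρ i.k ∧ i.Λs = cubeLamS θ.L a M ρ i.k ∧ i.Λb = cubeLamB θ.L a M ρ i.k}) (m : ℕ),
      AvgAtβ θ.L ops q M j.1 m)
    (hc₆ : 0 < c₆) (hK₆ : 0 < K₆) (ha₃ : 0 < a₃) (hc69 : 0 ≤ c69) (hq : 0 ≤ q)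
    {B₀' C₂ cu cP : ℝ} (hB₀' : 0 < B₀') (hC₂ : 2097152 * ((θ.D : ℝ) + 1) ^ 2 ≤ C₂) (hcu : 0 < cu) (hcP : 0 < cP) :
    ∃ B₀S : ℝ, 1 ≤ B₀S ∧
      ((∀ i : {i : ZdIdx θ.D θ.L // ∃ (a : Site θ.D) (M ρ : ℕ), θ.L ≤ ρ ∧ ρ ≤ M ∧ 11 * θ.D < M ∧ θ.L ≤ θ.D * M ∧
          i.Ω = cubeFam false θ.L a M ρ i.k ∧ i.Λs = cubeLamS θ.L a M ρ i.k ∧ i.Λb = cubeLamB θ.L a M ρ i.k},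
          SockP5base (𝔸 := θ.𝔸) θ.L B₀S B₀' cP i.1.η i.1.k i.1.Ω i.1.Λs) →
       (∀ i : {i : ZdIdx θ.D θ.L // ∃ (a : Site θ.D) (M ρ : ℕ), θ.L ≤ ρ ∧ ρ ≤ M ∧ 11 * θ.D < M ∧ θ.L ≤ θ.D * M ∧
          i.Ω = cubeFam false θ.L a M ρ i.k ∧ i.Λs = cubeLamS θ.L a M ρ i.k ∧ i.Λb = cubeLamB θ.L a M ρ i.k},
          SockP5 (𝔸 := θ.𝔸) θ.L B₀S B₀' cP i.1.η i.1.k i.1.Ω i.1.Λs) →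
       (∀ i : {i : ZdIdx θ.D θ.L // ∃ (a : Site θ.D) (M ρ : ℕ), θ.L ≤ ρ ∧ ρ ≤ M ∧ 11 * θ.D < M ∧ θ.L ≤ θ.D * M ∧
          i.Ω = cubeFam false θ.L a M ρ i.k ∧ i.Λs = cubeLamS θ.L a M ρ i.k ∧ i.Λb = cubeLamB θ.L a M ρ i.k},
          SockP5u (𝔸 := θ.𝔸) θ.L cP cu i.1.η i.1.k i.1.Ω i.1.Λs) →
       ∃ c₁ : ℝ, 0 < c₁ ∧
         B8.Prop6Printed θ.D (θ.L : ℝ) (5 * (θ.D : ℝ) * θ.L * B₀S) c₁ (Node00.cubB8OfRecord θ)) := by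
  obtain ⟨B₀S, hB₀S, H⟩ := prop6Printed_zdCub_of_thm33β (𝔸 := θ.𝔸) hD θ.two_le_L geo bg GA mem ιCfg ιLoc ops h33 hdict hP6 hinv
    hcurv hlan havg hc₆ hK₆ ha₃ hc69 hq hB₀' hC₂ hcu hcP
  refine ⟨B₀S, hB₀S, fun SP5base SP5 SP5u => ?_⟩
  obtain ⟨c₁, hc₁, G⟩ := H SP5base SP5 SP5u
  exact ⟨c₁, hc₁, G (fun i : Node00.IdxB8 θ => i.1)⟩

#print axioms prop6Printed_cubB8OfRecord_of_thm33β

/-! ## §2 The N05 leaf face from an all-levels β socket family on the cube sub-family -/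

/-- ★★ **THE N05 LEAF FACE FROM AN ALL-LEVELS FOUR-LINE β SOCKET FAMILY ON THE CUBE SUB-FAMILY — BINDER-AGNOSTIC, WINDOW-FREE**: p538766's
`b8LeafRS_zd3_map_of_sockD4Family` with the socket token `SockB9P3D4 ↦ SockB9P3D4β` (the consumer underneath is this seat's β chain,
`B8LeafKnitZd3CubBdryBeta.prop6Printed_zdCub_of_sockD4βFamily`); Proposition 5's sockets at `(inp.B₀, inp.B₀') = (B₀ˢ, B₀′)`, `B₀ˢ = max{max{1,B₀}, 4B_∂/(dL−1)}`.
dag-n06-b's `sockB9P3D4β_allLevels_of_thm33_on` supplies `hall` from `B9.Thm33Printed` + six member-local binders (see `prop6Printed_zdCub_of_thm33β`).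
[cite: Balaban1985RegularSpaces, Lemma 1 p.79, Thm 2 p.83, Prop. 3 p.87, Thm 4 p.88, Prop. 6 p.99 (derived); Prop. 5 p.94, Prop. 7 p.100, Thm 8 p.101 (named hypotheses), (1.59) p.86, (1.31) p.82] -/
theorem b8LeafRS_zd3_map_of_sockD4βFamily (hd2 : 2 ≤ d) {L : ℕ} (hL : 2 ≤ L) {B₀ Bbd cP₉ : ℝ} (hBbd : 0 ≤ Bbd) (hcP₉ : 0 < cP₉)
    (hall : ∀ (j : {i : ZdIdx d L // ∃ (a : Site d) (M ρ : ℕ), L ≤ ρ ∧ ρ ≤ M ∧ 11 * d < M ∧ L ≤ d * M ∧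
          i.Ω = cubeFam false L a M ρ i.k ∧ i.Λs = cubeLamS L a M ρ i.k ∧ i.Λb = cubeLamB L a M ρ i.k}) (m : ℕ), m ≤ j.1.k →
      SockB9P3D4β (𝔸 := 𝔸) L B₀ Bbd cP₉ j.1.η m j.1.Ω j.1.Λs j.1.Λb)
    (Lb : ℕ) (β : ℝ) (len : Site d → ℝ) {B₀' B₀β C₂ C₂c cu cP B₂ : ℝ} (hB₀' : 0 < B₀') (hB₀β : 0 < B₀β)
    (hC₂ : 2097152 * ((d : ℝ) + 1) ^ 2 ≤ C₂) (hC₂c : 2097152 * ((d : ℝ) + 1) ^ 2 ≤ C₂c) (hcu : 0 < cu) (hcP : 0 < cP) :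
    ∀ (inp : B8.B9Inputs), inp.B₀ = max (max 1 B₀) (4 * Bbd / ((d : ℝ) * L - 1)) → inp.B₀' = B₀' →
      (∀ i : {i : ZdIdx d L // ∃ (a : Site d) (M ρ : ℕ), L ≤ ρ ∧ ρ ≤ M ∧ 11 * d < M ∧ L ≤ d * M ∧
          i.Ω = cubeFam false L a M ρ i.k ∧ i.Λs = cubeLamS L a M ρ i.k ∧ i.Λb = cubeLamB L a M ρ i.k},
          SockP5base (𝔸 := 𝔸) L inp.B₀ inp.B₀' cP i.1.η i.1.k i.1.Ω i.1.Λs) →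
       (∀ i : {i : ZdIdx d L // ∃ (a : Site d) (M ρ : ℕ), L ≤ ρ ∧ ρ ≤ M ∧ 11 * d < M ∧ L ≤ d * M ∧
          i.Ω = cubeFam false L a M ρ i.k ∧ i.Λs = cubeLamS L a M ρ i.k ∧ i.Λb = cubeLamB L a M ρ i.k},
          SockP5 (𝔸 := 𝔸) L inp.B₀ inp.B₀' cP i.1.η i.1.k i.1.Ω i.1.Λs) →
       (∀ i : {i : ZdIdx d L // ∃ (a : Site d) (M ρ : ℕ), L ≤ ρ ∧ ρ ≤ M ∧ 11 * d < M ∧ L ≤ d * M ∧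
          i.Ω = cubeFam false L a M ρ i.k ∧ i.Λs = cubeLamS L a M ρ i.k ∧ i.Λb = cubeLamB L a M ρ i.k},
          SockP5u (𝔸 := 𝔸) L cP cu i.1.η i.1.k i.1.Ω i.1.Λs) →
      ∃ c₁ : ℝ, 0 < c₁ ∧ ∀ {J : Type} (ι : J → ZdIdx d L), (∀ j, (ι j).Ω 0 = Set.univ) →
        B8.Thm4Printed (5 * (d : ℝ) * L * inp.B₀) (fun j : J => (zdGF3 𝔸 L β len (ι j)).toGFData) →
        B8.Prop3Printed d (L : ℝ) (2097152 * ((d : ℝ) + 1) ^ 2) inp B₀β (fun j : J => (zdGF3 𝔸 L β len (ι j)).toGFData2) →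
        ∀ {ι' : Type} (f : ι' → ZdIdx d L),
        ∀ {toAxial : ∀ j : J, (zdGF3 𝔸 L β len (ι j)).Cfg → (zdGF3 𝔸 L β len (ι j)).Pert → (zdGF3 𝔸 L β len (ι j)).Pert},
        B8.Prop5Exists inp.B₀' (5 * (d : ℝ) * L * inp.B₀) lan → B8.Prop5Unique lan →
        B8SectGH.Prop7PrintedR (fun j : J => zdGF3 𝔸 L β len (ι j)) toAxial →
        B8Thm8Surviving.Thm8SurvivingAt 1 (5 * (d : ℝ) * L * inp.B₀) B₂ (fun j : J => zdGF3 𝔸 L β len (ι j)) →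
        B8LeafRS d (L : ℝ) C₂ (5 * (d : ℝ) * L * inp.B₀) inp.B₀' (5 * (d : ℝ) * L * inp.B₀) B₂ c₁ inp B₀β (blockPairNA d Lb 𝔸)
          (fun j : J => zdGF3 𝔸 L β len (ι j)) lan (fun j : ι' => zdCub 𝔸 L (f j)) toAxial := by
  have hLr : (2 : ℝ) ≤ L := by exact_mod_cast hL
  have hdr : (2 : ℝ) ≤ d := by exact_mod_cast hd2
  intro inp hinp hinp' SP5base SP5 SP5u
  have hB₀D1 : 1 ≤ inp.B₀ := by rw [hinp]; exact (le_max_left 1 B₀).trans (le_max_left _ _)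
  have hB : 2 ≤ 5 * (d : ℝ) * L * inp.B₀ := by
    have h1 : (2 : ℝ) ≤ 5 * (d : ℝ) * L := by nlinarith [hLr, hdr]
    nlinarith [h1, hB₀D1]
  obtain ⟨c₁, hc₁, P6⟩ := B8LeafKnitZd3CubBdryBeta.prop6Printed_zdCub_of_sockD4βFamily (𝔸 := 𝔸) hd2 hL (C₂ := C₂c) hBbd hcP₉ hB₀' hC₂c hcu hcP hall
    (fun i => by rw [← hinp, ← hinp']; exact SP5base i) (fun i => by rw [← hinp, ← hinp']; exact SP5 i) SP5u
  refine ⟨c₁, hc₁, fun ι hΩ H4 H3 _ f _ p5e p5u p7 t8 => ?_⟩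
  have p6 : B8.Prop6Printed d (L : ℝ) (5 * (d : ℝ) * L * inp.B₀) c₁ (fun j => zdCub 𝔸 L (f j)) := by rw [hinp]; exact P6 f
  exact
    { l1 := lemma1Printed_blockPairNA d Lb 𝔸
      t2 := thm2Printed_zd3_map_of_thm4 hd2 hL inp.B₀_pos inp.B₀'_pos hB₀β hB ι hΩ H4 H3
      p3 := prop3Printed_of_C₂_le hC₂ H3
      t4 := H4
      p5e := p5e
      p5u := p5u
      p6 := p6
      p7 := p7
      t8 := t8 }

#print axioms b8LeafRS_zd3_map_of_sockD4βFamily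

/-! ## §3 (v1.1, seat g9) The junction knit with Proposition 5's parameters quantified AFTER `B₀ˢ` — dag-n05-d's plug shape

dag-n05-d g8 (`HOME/pub-ymgap-dag-n05-d/P6-PLUG-T3.md` item 1) located a PLUG SHAPE PROBLEM in `prop6Printed_zdCub_of_thm33β`: its Proposition-5 parameters
`{B₀' C₂ cu cP}` are bound BEFORE `∃ B₀S`, whereas a letters-based supplier of `SockP5base ∕ SockP5 ∕ SockP5u` at the cube members chooses its thresholds `cP, cu`
AFTER the constant `B₀ˢ` it must serve (`B8SockSP5UniformThresholdsSrc.exists_uniform_threshold_sp5*_src`).  The witness for `B₀ˢ` in §1 is built from dag-n06-b's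
`sockB9P3D4β_allLevels_of_thm33_on` alone (Theorem 3.3's block + the six member-local binders), so the order can be exchanged at no cost; the idle `C₂` binder of §1
(it never reaches the conclusion) is instantiated internally and dropped from the interface. -/

/-- ★★★ **PROPOSITION 6 ON THE CUBE MEMBERS FROM [4] THEOREM 3.3 BY NAME, EDITION β — UNIFORM PLUG SHAPE**: as `prop6Printed_zdCub_of_thm33β`, but the constant
`B₀ˢ ≥ 1` is produced FIRST and Proposition 5's parameters `B₀′ > 0`, `cu > 0`, `cP > 0` (with the three sockets at `(B₀ˢ, B₀′, cP, cu)`) are quantified AFTER it —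
the shape dag-n05-d's record knits consume (`P6-PLUG-T3.md` item 1); no `C₂` binder.  Same proof, same A6 line as §1 (binders inhabited at every cube member at
`m = 0` by dag-n06-b's `Witness.binders_inhabited_cube_zero`; `m ≥ 1`, `B9.Thm33Printed`, Proposition 5's sockets NOT witnessed; no joint-satisfiability claim).
[cite: Balaban1985RegularSpaces, Prop. 6 p.99, Prop. 3 p.87, Thm 4 p.88, Prop. 5 p.94, (1.56)–(1.62) pp.86–87, (1.31) p.82; Balaban1985BackgroundPropagators, Thm 3.3 p.399, (3.16) p.393] -/
theorem prop6Printed_zdCub_of_thm33β_uniform (hd2 : 2 ≤ d) {L : ℕ} (hL : 2 ≤ L)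
    {I : Type} (geo : I → B9.Geometry) (bg : I → B9.Backgrounds) (GA : ∀ i, B9.KernelFamily (geo i) (bg i))
    (mem : ℝ → ZdIdx d L → ℕ → I)
    (ιCfg : ∀ (M : ℝ) (i : ZdIdx d L) (m : ℕ) (U₀ : Site d → Fin d → 𝔸ˣ), (∀ x κ, U₀ x κ ∈ unitaryUnits 𝔸) → (bg (mem M i m)).Cfg)
    (ιLoc : ∀ (M : ℝ) (i : ZdIdx d L) (m : ℕ), (Site d → Fin d → 𝔸) → (geo (mem M i m)).Loc)
    (ops : ℝ → ZdIdx d L → ℕ → OpsZd d 𝔸) {c35 c₆ K₆ M₃ a₃ c69 q : ℝ}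
    {Gp : ∀ i, B9.KernelFamily (geo i) (bg i)} (h33 : B9.Thm33Printed c35 geo bg Gp GA)
    (hdict : ∀ (M : ℝ) (j : {i : ZdIdx d L // ∃ (a : Site d) (M ρ : ℕ), L ≤ ρ ∧ ρ ≤ M ∧ 11 * d < M ∧ L ≤ d * M ∧
          i.Ω = cubeFam false L a M ρ i.k ∧ i.Λs = cubeLamS L a M ρ i.k ∧ i.Λb = cubeLamB L a M ρ i.k}) (m : ℕ),
      DictAt geo bg GA L mem ιCfg ιLoc ops M j.1 m)
    (hP6 : ∀ (M : ℝ) (j : {i : ZdIdx d L // ∃ (a : Site d) (M ρ : ℕ), L ≤ ρ ∧ ρ ≤ M ∧ 11 * d < M ∧ L ≤ d * M ∧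
          i.Ω = cubeFam false L a M ρ i.k ∧ i.Λs = cubeLamS L a M ρ i.k ∧ i.Λb = cubeLamB L a M ρ i.k}) (m : ℕ),
      M₃ ≤ M → Prop6At bg L mem ιCfg c35 c₆ K₆ M j.1 m)
    (hinv : ∀ (M : ℝ) (j : {i : ZdIdx d L // ∃ (a : Site d) (M ρ : ℕ), L ≤ ρ ∧ ρ ≤ M ∧ 11 * d < M ∧ L ≤ d * M ∧
          i.Ω = cubeFam false L a M ρ i.k ∧ i.Λs = cubeLamS L a M ρ i.k ∧ i.Λb = cubeLamB L a M ρ i.k}) (m : ℕ),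
      M₃ ≤ M → InvAt bg L mem ιCfg ops c35 a₃ M j.1 m)
    (hcurv : ∀ (M : ℝ) (j : {i : ZdIdx d L // ∃ (a : Site d) (M ρ : ℕ), L ≤ ρ ∧ ρ ≤ M ∧ 11 * d < M ∧ L ≤ d * M ∧
          i.Ω = cubeFam false L a M ρ i.k ∧ i.Λs = cubeLamS L a M ρ i.k ∧ i.Λb = cubeLamB L a M ρ i.k}) (m : ℕ),
      M₃ ≤ M → CurvAt bg L mem ιCfg ops c35 a₃ c69 M j.1 m)
    (hlan : ∀ (M : ℝ) (j : {i : ZdIdx d L // ∃ (a : Site d) (M ρ : ℕ), L ≤ ρ ∧ ρ ≤ M ∧ 11 * d < M ∧ L ≤ d * M ∧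
          i.Ω = cubeFam false L a M ρ i.k ∧ i.Λs = cubeLamS L a M ρ i.k ∧ i.Λb = cubeLamB L a M ρ i.k}) (m : ℕ),
      M₃ ≤ M → LandauAt bg L mem ιCfg ops c35 a₃ M j.1 m)
    (havg : ∀ (M : ℝ) (j : {i : ZdIdx d L // ∃ (a : Site d) (M ρ : ℕ), L ≤ ρ ∧ ρ ≤ M ∧ 11 * d < M ∧ L ≤ d * M ∧
          i.Ω = cubeFam false L a M ρ i.k ∧ i.Λs = cubeLamS L a M ρ i.k ∧ i.Λb = cubeLamB L a M ρ i.k}) (m : ℕ),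
      AvgAtβ L ops q M j.1 m)
    (hc₆ : 0 < c₆) (hK₆ : 0 < K₆) (ha₃ : 0 < a₃) (hc69 : 0 ≤ c69) (hq : 0 ≤ q) :
    ∃ B₀S : ℝ, 1 ≤ B₀S ∧ ∀ {B₀' cu cP : ℝ}, 0 < B₀' → 0 < cu → 0 < cP →
      ((∀ i : {i : ZdIdx d L // ∃ (a : Site d) (M ρ : ℕ), L ≤ ρ ∧ ρ ≤ M ∧ 11 * d < M ∧ L ≤ d * M ∧
          i.Ω = cubeFam false L a M ρ i.k ∧ i.Λs = cubeLamS L a M ρ i.k ∧ i.Λb = cubeLamB L a M ρ i.k},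
          SockP5base (𝔸 := 𝔸) L B₀S B₀' cP i.1.η i.1.k i.1.Ω i.1.Λs) →
       (∀ i : {i : ZdIdx d L // ∃ (a : Site d) (M ρ : ℕ), L ≤ ρ ∧ ρ ≤ M ∧ 11 * d < M ∧ L ≤ d * M ∧
          i.Ω = cubeFam false L a M ρ i.k ∧ i.Λs = cubeLamS L a M ρ i.k ∧ i.Λb = cubeLamB L a M ρ i.k},
          SockP5 (𝔸 := 𝔸) L B₀S B₀' cP i.1.η i.1.k i.1.Ω i.1.Λs) →
       (∀ i : {i : ZdIdx d L // ∃ (a : Site d) (M ρ : ℕ), L ≤ ρ ∧ ρ ≤ M ∧ 11 * d < M ∧ L ≤ d * M ∧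
          i.Ω = cubeFam false L a M ρ i.k ∧ i.Λs = cubeLamS L a M ρ i.k ∧ i.Λb = cubeLamB L a M ρ i.k},
          SockP5u (𝔸 := 𝔸) L cP cu i.1.η i.1.k i.1.Ω i.1.Λs) →
       ∃ c₁ : ℝ, 0 < c₁ ∧ ∀ {ι' : Type} (f : ι' → ZdIdx d L),
         B8.Prop6Printed d (L : ℝ) (5 * (d : ℝ) * L * B₀S) c₁ (fun j => zdCub 𝔸 L (f j))) := by
  have hL1 : 1 ≤ L := le_trans (by norm_num) hL
  -- the cube members have `Margin2` (ρ ≥ L ≥ 2)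
  have hMJ : ∀ i : {i : ZdIdx d L // ∃ (a : Site d) (M ρ : ℕ), L ≤ ρ ∧ ρ ≤ M ∧ 11 * d < M ∧ L ≤ d * M ∧
      i.Ω = cubeFam false L a M ρ i.k ∧ i.Λs = cubeLamS L a M ρ i.k ∧ i.Λb = cubeLamB L a M ρ i.k}, Margin2 i.1.Ω := by
    rintro ⟨i, a, M, ρ, hρ, -, -, -, hΩ, -, -⟩
    dsimp only
    rw [hΩ]
    exact margin2_cubeFam L a M (hL.trans hρ) i.k
  -- ONE call of dag-n06-b's β junction over the cube sub-family index: `B₀, cP9` depend on Theorem 3.3's block only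
  obtain ⟨B₀, cP9, hB₀, hcP9, hall⟩ := sockB9P3D4β_allLevels_of_thm33_on geo bg GA L mem ιCfg ιLoc ops hd2 hL1 h33
    (Subtype.val : {i : ZdIdx d L // ∃ (a : Site d) (M ρ : ℕ), L ≤ ρ ∧ ρ ≤ M ∧ 11 * d < M ∧ L ≤ d * M ∧
      i.Ω = cubeFam false L a M ρ i.k ∧ i.Λs = cubeLamS L a M ρ i.k ∧ i.Λb = cubeLamB L a M ρ i.k} → ZdIdx d L) hMJ
    hdict hP6 hinv hcurv hlan havg hc₆ hK₆ ha₃ hc69 hq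
  have hBbd : 0 ≤ (20 * (d : ℝ) + 2) * max 1 (2 * B₀ * max 1 q) := by positivity
  have hC₂ : 2097152 * ((d : ℝ) + 1) ^ 2 ≤ 2097152 * ((d : ℝ) + 1) ^ 2 := le_rfl
  refine ⟨max (max 1 (max 1 (2 * B₀ * max 1 q))) (4 * ((20 * (d : ℝ) + 2) * max 1 (2 * B₀ * max 1 q)) / ((d : ℝ) * L - 1)),
    (le_max_left _ _).trans (le_max_left _ _), fun hB₀' hcu hcP SP5base SP5 SP5u => ?_⟩
  exact prop6Printed_zdCub_of_sockD4βFamily (𝔸 := 𝔸) hd2 hL hBbd hcP9 hB₀' hC₂ hcu hcP hall SP5base SP5 SP5u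

#print axioms prop6Printed_zdCub_of_thm33β_uniform

/-- ★ **THE RECORD FORM, UNIFORM PLUG SHAPE**: `prop6Printed_zdCub_of_thm33β_uniform` on NODE 00's member of record `Node00.cubB8OfRecord θ`
(`f := Subtype.val` on `Node00.IdxB8 θ`): `∃ B₀ˢ ≥ 1` FIRST, then for all `B₀′, cu, cP > 0` and Proposition 5's three sockets at `(B₀ˢ, B₀′, cP, cu)` on the
cube sub-family, `∃ c₁ > 0` with `B8.Prop6Printed θ.D θ.L (5dL·B₀ˢ) c₁ (cubB8OfRecord θ)` — the `p6` letter dag-n05-d's `…N05SubBHKnitUnivOfThm33` T3 plugs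
(any threshold `B₁₀ := 5dL·B₀ˢ`, any `c₁`).  A6 line as in §1.
[cite: Balaban1985RegularSpaces, Prop. 6 p.99, Thm 4 p.88, Prop. 3 p.87, Prop. 5 p.94, (1.59) p.86; Balaban1985BackgroundPropagators, Thm 3.3 p.399] -/
theorem prop6Printed_cubB8OfRecord_of_thm33β_uniform (θ : Node00.Stage3Params) (hD : 2 ≤ θ.D)
    {I : Type} (geo : I → B9.Geometry) (bg : I → B9.Backgrounds) (GA : ∀ i, B9.KernelFamily (geo i) (bg i))
    (mem : ℝ → ZdIdx θ.D θ.L → ℕ → I)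
    (ιCfg : ∀ (M : ℝ) (i : ZdIdx θ.D θ.L) (m : ℕ) (U₀ : Site θ.D → Fin θ.D → θ.𝔸ˣ), (∀ x κ, U₀ x κ ∈ unitaryUnits θ.𝔸) →
      (bg (mem M i m)).Cfg)
    (ιLoc : ∀ (M : ℝ) (i : ZdIdx θ.D θ.L) (m : ℕ), (Site θ.D → Fin θ.D → θ.𝔸) → (geo (mem M i m)).Loc)
    (ops : ℝ → ZdIdx θ.D θ.L → ℕ → OpsZd θ.D θ.𝔸) {c35 c₆ K₆ M₃ a₃ c69 q : ℝ}
    {Gp : ∀ i, B9.KernelFamily (geo i) (bg i)} (h33 : B9.Thm33Printed c35 geo bg Gp GA)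
    (hdict : ∀ (M : ℝ) (j : {i : ZdIdx θ.D θ.L // ∃ (a : Site θ.D) (M ρ : ℕ), θ.L ≤ ρ ∧ ρ ≤ M ∧ 11 * θ.D < M ∧ θ.L ≤ θ.D * M ∧
          i.Ω = cubeFam false θ.L a M ρ i.k ∧ i.Λs = cubeLamS θ.L a M ρ i.k ∧ i.Λb = cubeLamB θ.L a M ρ i.k}) (m : ℕ),
      DictAt geo bg GA θ.L mem ιCfg ιLoc ops M j.1 m)
    (hP6 : ∀ (M : ℝ) (j : {i : ZdIdx θ.D θ.L // ∃ (a : Site θ.D) (M ρ : ℕ), θ.L ≤ ρ ∧ ρ ≤ M ∧ 11 * θ.D < M ∧ θ.L ≤ θ.D * M ∧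
          i.Ω = cubeFam false θ.L a M ρ i.k ∧ i.Λs = cubeLamS θ.L a M ρ i.k ∧ i.Λb = cubeLamB θ.L a M ρ i.k}) (m : ℕ),
      M₃ ≤ M → Prop6At bg θ.L mem ιCfg c35 c₆ K₆ M j.1 m)
    (hinv : ∀ (M : ℝ) (j : {i : ZdIdx θ.D θ.L // ∃ (a : Site θ.D) (M ρ : ℕ), θ.L ≤ ρ ∧ ρ ≤ M ∧ 11 * θ.D < M ∧ θ.L ≤ θ.D * M ∧
          i.Ω = cubeFam false θ.L a M ρ i.k ∧ i.Λs = cubeLamS θ.L a M ρ i.k ∧ i.Λb = cubeLamB θ.L a M ρ i.k}) (m : ℕ),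
      M₃ ≤ M → InvAt bg θ.L mem ιCfg ops c35 a₃ M j.1 m)
    (hcurv : ∀ (M : ℝ) (j : {i : ZdIdx θ.D θ.L // ∃ (a : Site θ.D) (M ρ : ℕ), θ.L ≤ ρ ∧ ρ ≤ M ∧ 11 * θ.D < M ∧ θ.L ≤ θ.D * M ∧
          i.Ω = cubeFam false θ.L a M ρ i.k ∧ i.Λs = cubeLamS θ.L a M ρ i.k ∧ i.Λb = cubeLamB θ.L a M ρ i.k}) (m : ℕ),
      M₃ ≤ M → CurvAt bg θ.L mem ιCfg ops c35 a₃ c69 M j.1 m)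
    (hlan : ∀ (M : ℝ) (j : {i : ZdIdx θ.D θ.L // ∃ (a : Site θ.D) (M ρ : ℕ), θ.L ≤ ρ ∧ ρ ≤ M ∧ 11 * θ.D < M ∧ θ.L ≤ θ.D * M ∧
          i.Ω = cubeFam false θ.L a M ρ i.k ∧ i.Λs = cubeLamS θ.L a M ρ i.k ∧ i.Λb = cubeLamB θ.L a M ρ i.k}) (m : ℕ),
      M₃ ≤ M → LandauAt bg θ.L mem ιCfg ops c35 a₃ M j.1 m)
    (havg : ∀ (M : ℝ) (j : {i : ZdIdx θ.D θ.L // ∃ (a : Site θ.D) (M ρ : ℕ), θ.L ≤ ρ ∧ ρ ≤ M ∧ 11 * θ.D < M ∧ θ.L ≤ θ.D * M ∧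
          i.Ω = cubeFam false θ.L a M ρ i.k ∧ i.Λs = cubeLamS θ.L a M ρ i.k ∧ i.Λb = cubeLamB θ.L a M ρ i.k}) (m : ℕ),
      AvgAtβ θ.L ops q M j.1 m)
    (hc₆ : 0 < c₆) (hK₆ : 0 < K₆) (ha₃ : 0 < a₃) (hc69 : 0 ≤ c69) (hq : 0 ≤ q) :
    ∃ B₀S : ℝ, 1 ≤ B₀S ∧ ∀ {B₀' cu cP : ℝ}, 0 < B₀' → 0 < cu → 0 < cP →
      ((∀ i : {i : ZdIdx θ.D θ.L // ∃ (a : Site θ.D) (M ρ : ℕ), θ.L ≤ ρ ∧ ρ ≤ M ∧ 11 * θ.D < M ∧ θ.L ≤ θ.D * M ∧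
          i.Ω = cubeFam false θ.L a M ρ i.k ∧ i.Λs = cubeLamS θ.L a M ρ i.k ∧ i.Λb = cubeLamB θ.L a M ρ i.k},
          SockP5base (𝔸 := θ.𝔸) θ.L B₀S B₀' cP i.1.η i.1.k i.1.Ω i.1.Λs) →
       (∀ i : {i : ZdIdx θ.D θ.L // ∃ (a : Site θ.D) (M ρ : ℕ), θ.L ≤ ρ ∧ ρ ≤ M ∧ 11 * θ.D < M ∧ θ.L ≤ θ.D * M ∧
          i.Ω = cubeFam false θ.L a M ρ i.k ∧ i.Λs = cubeLamS θ.L a M ρ i.k ∧ i.Λb = cubeLamB θ.L a M ρ i.k},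
          SockP5 (𝔸 := θ.𝔸) θ.L B₀S B₀' cP i.1.η i.1.k i.1.Ω i.1.Λs) →
       (∀ i : {i : ZdIdx θ.D θ.L // ∃ (a : Site θ.D) (M ρ : ℕ), θ.L ≤ ρ ∧ ρ ≤ M ∧ 11 * θ.D < M ∧ θ.L ≤ θ.D * M ∧
          i.Ω = cubeFam false θ.L a M ρ i.k ∧ i.Λs = cubeLamS θ.L a M ρ i.k ∧ i.Λb = cubeLamB θ.L a M ρ i.k},
          SockP5u (𝔸 := θ.𝔸) θ.L cP cu i.1.η i.1.k i.1.Ω i.1.Λs) →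
       ∃ c₁ : ℝ, 0 < c₁ ∧
         B8.Prop6Printed θ.D (θ.L : ℝ) (5 * (θ.D : ℝ) * θ.L * B₀S) c₁ (Node00.cubB8OfRecord θ)) := by
  obtain ⟨B₀S, hB₀S, H⟩ := prop6Printed_zdCub_of_thm33β_uniform (𝔸 := θ.𝔸) hD θ.two_le_L geo bg GA mem ιCfg ιLoc ops h33 hdict hP6
    hinv hcurv hlan havg hc₆ hK₆ ha₃ hc69 hq
  refine ⟨B₀S, hB₀S, fun hB₀' hcu hcP SP5base SP5 SP5u => ?_⟩
  obtain ⟨c₁, hc₁, G⟩ := H hB₀' hcu hcP SP5base SP5 SP5u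
  exact ⟨c₁, hc₁, G (fun i : Node00.IdxB8 θ => i.1)⟩

#print axioms prop6Printed_cubB8OfRecord_of_thm33β_uniform

end Literature.MathematicalPhysics.QuantumFieldTheory.Balaban1983to89.B8Prop6CubeMemberOfThm33Beta

end

/-! ## HONEST SCOPE — VACUOUS AS TYPED (2026-08-27, seat `pub-ymgap-dag-n05-e` g9; director-ym LINE №196, dag-lead DEDUP-349∕350)

Every theorem of this file whose hypotheses contain a (1.59)-type clause or socket in EDITION β at a CUBE MEMBER of (1.131) — the SCALAR clauses
SC2∕SC4, the 𝔸-valued sockets `SockB9P3D4β` ∕ `H59Dβ` ∕ the four-line Prop.-3-frame socket, or a hypothesis SET that yields them (`B9.Thm33Printed` +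
dag-n06-b's member-local binders at every truncation) — is VACUOUS AS TYPED: the averaging datum is read over `B8CubeMemberZd.cubeLamB`, whose condition 1
«fine box ⊂ □_j» EMPTIES print's crossing bonds of (1.31) at levels `j ≥ 1`, and the interior SHELL GAUGE MODES `∂(𝟙λ)`, `λ ⊂ □_j`, then defeat the clause at
every cube member with `k ≥ 1` for ALL constants `B₀, B_∂` — KERNEL CERTIFICATE dag-n05-c `B8Ineq159FlatShellModeVacuity` (p572834:
`not_flat159β_two_cubeMember(_one)`, `sc2_uninhabited_cubeB8`; ref-E g12 READ-11 A6-FINAL), `Ω₀ = ℤᵈ` twin `…ShellModeVacuityUniv` (p576185).  The theorems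
stay TRUE and PASS-AS-DECLARED; their content at cube members is nil.  Nothing of [Balaban1985RegularSpaces] is refuted: print's class ([B6] (2.3), «at least
one end-point in Ω_j^{(j)}») contains the crossing bonds and kills the modes (dag-n05-c `B8Ineq159FlatShellModeCrossingDatum`).  SUPERSEDED BY EDITION γ: the
datum class of record becomes dag-n05-c's `B8Ineq159FlatCubeMemberPrinted.cubeLamBP` (p573921∕p575549), the socket dag-n06-b's `B9SupplySockB9P3ZdGamma`, the
Theorem-4 driver this seat's `B8Eq142KLevelLocalGamma` ∕ `B8Thm4KLevelGamma`; this file is kept as history and for its class-independent mechanics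
(composition shape, ⊗-id transfer, the level-0 crossing MOVE), re-run by token swap in γ.  Count-neutral; N05 NOT discharged; nothing continuum ∕ ℝ⁴ ∕ OS ∕
mass-gap ∕ Clay. -/
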